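import Summits.QuantumFields.YangMills.Theorems.BalabanUVNodesN22KernelFadingOfTermSecondDiff
import Summits.QuantumFields.YangMills.Theorems.BalabanUVNodesN22AtU3OfKernels

/-!
# BalabanUVNodes ∕ node N22 = NE9 — «J38 AT THE RECORD» ON THE HONEST INTERFACE (a term-level second-difference letter) AND ITS PRINT-FAITHFUL SECTOR EDITION: K3's `h9` WITH THE
# RECORD's GEOMETRIC MODULI from node N18's kernel step rate + SECTOR holomorphy with quadratic vanishing at zero coupling in every young coupling + the printed output bound —
# NO disc through `g = 0`, NO `EHoloAt` (the uniform-disc last-coupling binder of J40 ∕ J42 ∕ J43 ∕ J44 REPAIRED under the record's possibility-1 χ-species)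

Cell `pub-ymgap`, HUMAN RULING D-0062 (Track A), R134 seat `pub-ymgap-dag-n22-c` (strategy s1), generation 15, module J46.  THEOREMS ONLY (no `def`, no `sorry`, standard axioms);
`--kind proof --supports stmt-QuantumFields-27366 --as helper` (K3⁸ `SpineGivenEndpointR13SepCoPHV`, skeleton v6 — §2b N22 face `h9` verbatim), COUNT-NEUTRAL.  Imports module J45
`…N22KernelFadingOfTermSecondDiff` (`norm_secondDiff_le_of_sectorHolo`, `kernelSecondDiff_objectsOfRecord₁₃_of_termSecondDiff`; through it J38–J41) and dag-n22-w3's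
`…N22AtU3OfKernels` (the pin face).  Nothing re-declared; every step is plain application.

WHY (LOCATED — this lane's g6 honesty rider 26′ `…N22W1StripLastTermwiseVertexRider`, re-read at g15, bus A6 SELF-FLAG 2026-08-28).  The kernel-fading road's editions J40 (`hL`, one
radius for every coordinate), J42∕J44 (N09's `EHoloAt` families), J43 (`EHoloAt` for the last coordinate) — and dag-n22-w5's print-level twins — ask holomorphy on closed discs of ONE
radius about every `t ∈ [0, γ]`: discs CONTAINING zero coupling, possibility-2 typing ([I] p. 266), inhabited only coupling-blind under the record's possibility-1 thresholds
`ε₁∕‖g‖` (26′).  The road itself needs only SECOND DIFFERENCES.  THIS FILE states the road on that honest interface and on its possibility-1 producer: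
* §1 ★★★ `ne9_EA_objectsOfRecord₁₃_of_kernelStepRate_termSecondDiff` — J40 §2 with the margin datum REPLACED by the TERM-LEVEL SECOND-DIFFERENCE LETTER `hΔ` (`M₂`); `DecayBound`
  displayed.
* §2 ★★★ `…_termSecondDiff_outputBound` — §1 with `DecayBound` DISCHARGED from the printed-type OUTPUT bound (1.18) on the space tables (J41 §1b + W1-21's transfer + node N18's
  junction): `E₀ := (16BB₃²∕r²)·e^{12Mδ₁}K₀K₁`, `κ_d := δ₁`.
* §3 ★★★ `…_of_kernelStepRate_sectorHolo` — THE SECTOR EDITION: for every young coordinate `i ≤ k` a holomorphic extension on the RELATIVE discs `closedBall s (c·s)`, `s ∈ ]0, γ]`,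
  with the CENTRED QUADRATIC bound `‖Ec z − V‖ ≤ B″·e^{−κ_E d}·s²` (module J45 §1 ⟹ `hΔ` with `M₂ = (6c² + 32c + 64)∕c²·B″`) + the output bound ⟹ `h9`.
* §4 ★★★ the pin face `n22At_rateCarriers_of_kernels_pin_of_kernelStepRate_sectorHolo` (every `k`, under `hpin`).
DISPLAYED INPUTS of §3, by owner: node N18's `KernelStepRateOfRecord₁₃` (N18; NE5 NOT PRINTED for d = 4); the sector datum (N09 for the last coupling ∕ N10–NODE A for older ones — the
cell's QUANTITATIVE reading of [I] p. 263 «C^∞ … (or analytic)», (2.12)–(2.13) p. 268 «vanishes at g_k = 0» and the `(g, B) ↦ (−g, −B)` parity under possibility 1; NOT a printed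
display); the output bound (printed TYPE (1.18), N10 ∕ NODE A at the towers of record); term holomorphy through the readings ∕ chart + space clauses ∕ site-weight tails (NODE A ∕ N09);
W1-20's law (NODE A ∕ def-W1); (1.21) (dag-n22-w3's road); letter rows (jointly satisfiable with `ℓ.Signs`, J42 §2).

HONEST FRAMING (binding).  Count-neutral COMPOSITION; NO estimate of Bałaban's is proved or asserted; nothing of the record is constructed or claimed to meet the displayed inputs;
N22 is NOT discharged (typed 28∕28 · discharged 5∕27 UNCHANGED); K3⁸ OPEN and NOT claimed (no stub of 27366 touched); NE9 is NOT IN PRINT for d = 4; no count claim; one finite 𝕋⁴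
programme at fixed ε — R4 closes the CONDITIONAL rung `BalabanLadder.UV` only; NOTHING about the continuum limit, ℝ⁴, infinite volume, OS axioms, a mass gap or the Clay problem
is proved or claimed.  References (TYPES only, no cite tags on the Summit side): [I] = Bałaban, CMP 109 (1987) Thm 1 p. 259, (1.7) p. 261, §1 p. 263 with (1.18), (1.20)–(1.22)
p. 264, (2.9) p. 266, (2.12)–(2.13) p. 268, p. 282 (site-weight tails: the sentence after (4.4)), (4.35)–(4.37) pp. 290–291, (5.10) p. 293; [II] = CMP 116 (1988) (2.3) p. 12,
(2.13)–(2.14) pp. 14–15; King, CMP 102 (1986) Lemma 4.5 (the N18 mechanism's print).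
-/

noncomputable section

open Filter Topology Set Metric
open scoped BigOperators

namespace YMDAG.N22.KernelFading

open Literature.MathematicalPhysics.QuantumFieldTheory.Balaban1983to89
open Literature.MathematicalPhysics.QuantumFieldTheory.Balaban1983to89.T4Continuum (T4Family ULoop)
open Literature.MathematicalPhysics.QuantumFieldTheory.Balaban1983to89.T4OutputRate (Carriers Functional Window NE9 DecayBound)
open Literature.MathematicalPhysics.QuantumFieldTheory.Balaban1983to89.TreeLengthTorus (TPt)
open Literature.MathematicalPhysics.QuantumFieldTheory.Balaban1983to89.B12TreeDecay (K₀ kappa₀ K₀_pos)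
open Literature.MathematicalPhysics.QuantumFieldTheory.Balaban1983to89.B12Decay510 (delta1)
open Literature.MathematicalPhysics.QuantumFieldTheory.Balaban1983to89.B12Decay510Window (K₁ K₁_nonneg)
open Literature.MathematicalPhysics.QuantumFieldTheory.Balaban1983to89.B12Decay510Torus (distCT nearT)
open Literature.MathematicalPhysics.QuantumFieldTheory.Balaban1983to89.B12Sec2to5 (l1)
open Literature.MathematicalPhysics.QuantumFieldTheory.Balaban1983to89.Node00 (Stage13Params Stage13HParams U3Letters₁₁ MatA)
open Literature.MathematicalPhysics.QuantumFieldTheory.Balaban1983to89.Node00.Sect2 (domSys domCount CPair)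
open Literature.MathematicalPhysics.QuantumFieldTheory.Balaban1983to89.Node00.W1
open Literature.MathematicalPhysics.QuantumFieldTheory.Balaban1983to89.Node00.LocalizedSum17 (localizedSum ReadingMaps Localizes17OfRecord₁₃)
open Literature.MathematicalPhysics.QuantumFieldTheory.Balaban1983to89.Node00.U3OfKernels (histPrefix objectsOfRecord₁₃)
open Literature.MathematicalPhysics.QuantumFieldTheory.Balaban1983to89.Node00.U3KernelLetters (KernelStepRateOfRecord₁₃ PolLimitsExistOfRecord₁₃)
open Literature.MathematicalPhysics.QuantumFieldTheory.Balaban1983to89.Node00.U3KernelLetters2 (windowedDecayUniformOfRecord₁₃_iff_of_localizes)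
open YMDAG.N22.UniformDecay (windowedDecayUniform_localizedSum_of_outputBound)
open YMDAG.N18.KernelLettersJunctions (decayBound_EA_of_windowedDecayUniform)
open Summit.QuantumFields.YangMills.BalabanUVNodes.N18KingModelOneRun (decayBound_mono)
open YMDAG.N18.KernelStepRateKingMechanism (kernelStepRate_mono)
open YMDAG.UVSplit (N22At RateReading₁₃CoPH rateCarriersOfRecord₁₃CoPH)
open YMDAG.N22.AtKernels (n22At_rateCarriers_of_kernels_pin_of_ne9)

open scoped Matrix.Norms.L2Operator

variable (F : T4Family) (N : ℕ) [NeZero N] {𝔸 : Type*} {M : ℕ}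

/-! ## §1 K3's `h9` with the GEOMETRIC moduli from node N18's kernel step rate + a TERM-LEVEL second-difference letter (J40 §2 re-keyed) -/

open Classical in
/-- ★★★ **«J38 AT THE RECORD» ON THE HONEST INTERFACE.**  At a Stage-13 tuple `θ` (`0 < θ.γ`) with a letter block `ℓ` (`ℓ.Signs`): node N18's `KernelStepRateOfRecord₁₃ F N θ κ₅ ℓ.θ₅ C₅`;
the uniform kernel decay `DecayBound ((objectsOfRecord₁₃ F N θ ℓ).EA 0) (Window θ.γ) E₀ κ_d` (displayed; §2 discharges it from an output bound); the TERM-LEVEL SECOND-DIFFERENCE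
LETTER `hΔ` (`M₂ ≥ 0`: `‖E(X; g∣g_i:=t+d) − 2E(X; g∣g_i:=t) + E(X; g∣g_i:=t−d)‖ ≤ M₂·e^{−κ_E d_{k+1}(X)}·d²` on the space tables, every torus∕level∕young coordinate∕box history∕step);
term holomorphy through the complexified readings of record, chart∕space clauses, site-weight tails, W1-20's law, (1.21); the rows `δ₁ ≤ κ₅`, `δ₁ ≤ κ_d`, `0 < ℓ.ω`, `ℓ.θ₅ ≤ ℓ.ω²`,
`ℓ.κ ≤ δ₁`, `(4·(2C₅∕(1−ℓ.θ₅) + 2E₀)∕θ.γ + C₂·θ.γ∕2)∕ℓ.ω ≤ ℓ.C₉` with `C₂ = (16M₂B₃²∕r²)·e^{12Mδ₁}K₀K₁` ⟹ **`NE9 ((objectsOfRecord₁₃ F N θ ℓ).EA 0) (Window θ.γ) ℓ.κ ℓ.moduli`** —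
module J45 §3 into J38 §2 (rates lowered to `δ₁`).  The letter is the road's honest interface: J39 §1 (one radius — possibility-2 typing), J45 §1 (SECTOR with quadratic vanishing —
possibility 1, §3 below) and print's real `C²`∕`C^∞` clause are its producers.  LOCATED (hypothesis form); N22 NOT discharged. [folklore] -/
theorem ne9_EA_objectsOfRecord₁₃_of_kernelStepRate_termSecondDiff (θ : Stage13Params F N) (ℓ : U3Letters₁₁) (hs : ℓ.Signs) (hγ : 0 < θ.γ)
    (hlim : PolLimitsExistOfRecord₁₃ F N θ) {κ₅ κd C₅ E₀ : ℝ} (hC₅ : 0 ≤ C₅) (hE₀ : 0 ≤ E₀)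
    (h5 : KernelStepRateOfRecord₁₃ F N θ κ₅ ℓ.θ₅ C₅) (hdec : DecayBound ((objectsOfRecord₁₃ F N θ ℓ).EA 0) (Window θ.γ) E₀ κd)
    (m' : ℕ) (M : ℕ) [NeZero M] (hM : M = F.L ^ m')
    (S : (K : ℕ) → ClusterTower (F.P K) 𝔸 M) (emb : ReadingMaps F (MatA N) 𝔸) (hloc : Localizes17OfRecord₁₃ F N θ S emb)
    (sp : (K k : ℕ) → (domSys (F.P K) M (k + 1)).Dom → Set (CPair (F.P K) 𝔸))
    {κ κE δ₀ B₃ r M₂ : ℝ}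
    (hκ₀ : kappa₀ (4 * 2 ^ 4) (2 * 4) ≤ κ / 2) (hδ₀ : 0 < δ₀) (hB₃ : 0 ≤ B₃) (hr : 0 < r) (hM₂ : 0 ≤ M₂) (hκE : κ ≤ κE)
    (hΔ : ∀ (K k : ℕ) (i : Fin (k + 1)), ∀ g ∈ box θ.γ k, ∀ (X : (domSys (F.P K) M (k + 1)).Dom), ∀ φ ∈ sp K k X, ∀ t d : ℝ, 0 < d →
      t - d ∈ Ioc (0 : ℝ) θ.γ → t + d ∈ Ioc (0 : ℝ) θ.γ →
        ‖((S K) k).E (Function.update g i (t + d)) φ X - 2 * ((S K) k).E (Function.update g i t) φ X + ((S K) k).E (Function.update g i (t - d)) φ X‖ ≤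
          M₂ * Real.exp (-(κE * (domSys (F.P K) M (k + 1)).dj X)) * d ^ 2)
    (Ec : ℕ → ℕ → Type*) [∀ K k, NormedAddCommGroup (Ec K k)] [∀ K k, NormedSpace ℂ (Ec K k)]
    (ι : letI := θ.instVβ₁; letI := θ.instVβ₂
      (K k : ℕ) → (domSys (F.P K) M (k + 1)).Dom → ((Fin (F.P K).d → Site (F.P K) (k + 1) → θ.Vβ) →L[ℝ] Ec K k))
    (Φ : (K k : ℕ) → (domSys (F.P K) M (k + 1)).Dom → Ec K k → CPair (F.P K) 𝔸)
    (U : (K k : ℕ) → (domSys (F.P K) M (k + 1)).Dom → Set (Ec K k)) (hU : ∀ K k X, IsOpen (U K k X)) (hrU : ∀ K k X, ball (0 : Ec K k) r ⊆ U K k X)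
    (hEhol : ∀ g ∈ Window θ.γ, ∀ (K k : ℕ) (X : (domSys (F.P K) M (k + 1)).Dom),
      DifferentiableOn ℂ (fun z => ((S K) k).E (histPrefix g k) (Φ K k X z) X) (U K k X))
    (hΦemb : letI := θ.instVβ₁; letI := θ.instVβ₂
      ∀ (K k : ℕ) (X : (domSys (F.P K) M (k + 1)).Dom) (Bf : Fin (F.P K).d → Site (F.P K) (k + 1) → θ.Vβ),
        Φ K k X (ι K k X Bf) = emb K k (fun l t => NormedSpace.exp (θ.ρ8 (Bf l t))))
    (hΦsp : ∀ (K k : ℕ) (X : (domSys (F.P K) M (k + 1)).Dom), ∀ z ∈ ball (0 : Ec K k) r, Φ K k X z ∈ sp K k X)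
    (w : (K k : ℕ) → (domSys (F.P K) M (k + 1)).Dom → Site (F.P K) (k + 1) → ℝ) (hw₀ : ∀ K k X t, 0 ≤ w K k X t)
    (hw : letI := θ.instVβ₁; letI := θ.instVβ₂; letI := θ.instιβ
      ∀ (K k : ℕ) (X : (domSys (F.P K) M (k + 1)).Dom) (l : Fin (F.P K).d) (t : Site (F.P K) (k + 1)) (c : θ.ιβ),
        ‖ι K k X (Pi.single l (Pi.single t (θ.bV c)))‖ ≤ w K k X t)
    (htail : ∀ (K k : ℕ) (X : (domSys (F.P K) M (k + 1)).Dom) (t : Site (F.P K) (k + 1)),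
      let e : Site (F.P K) (k + 1) → TPt 4 (domCount (F.P K) M (k + 1) * M) := fun x i => (ZMod.cast (x i) : ZMod (domCount (F.P K) M (k + 1) * M))
      w K k X t ≤ B₃ * Real.exp (-δ₀ * distCT (domCount (F.P K) M (k + 1)) M (e t) (nearT (M := M) (e t) X)))
    (hκ₅ : delta1 δ₀ κ ((M : ℝ) * 4) ≤ κ₅) (hκd : delta1 δ₀ κ ((M : ℝ) * 4) ≤ κd)
    (hω : 0 < ℓ.ω) (hθω : ℓ.θ₅ ≤ ℓ.ω ^ 2) (hℓκ : ℓ.κ ≤ delta1 δ₀ κ ((M : ℝ) * 4))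
    (hC₉ : (4 * (2 * C₅ / (1 - ℓ.θ₅) + 2 * E₀) / θ.γ +
        ((16 * M₂ * B₃ ^ 2 / r ^ 2) * Real.exp (delta1 δ₀ κ ((M : ℝ) * 4) * ((M : ℝ) * 4) * 3) * K₀ (4 * 2 ^ 4) (2 * 4) *
          K₁ 4 (δ₀ / 2)) * θ.γ / 2) / ℓ.ω ≤ ℓ.C₉) :
    NE9 ((objectsOfRecord₁₃ F N θ ℓ).EA 0) (Window θ.γ) ℓ.κ ℓ.moduli := by
  have hK : 0 < K₀ (4 * 2 ^ 4) (2 * 4) := K₀_pos _ _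
  have hC₂ : (0 : ℝ) ≤ ((16 * M₂ * B₃ ^ 2 / r ^ 2) * Real.exp (delta1 δ₀ κ ((M : ℝ) * 4) * ((M : ℝ) * 4) * 3) * K₀ (4 * 2 ^ 4) (2 * 4) *
          K₁ 4 (δ₀ / 2)) := by
    have := K₁_nonneg 4 (δ₀ / 2); positivity
  have h5' : KernelStepRateOfRecord₁₃ F N θ (delta1 δ₀ κ ((M : ℝ) * 4)) ℓ.θ₅ C₅ := by
    letI := θ.instVβ₁; letI := θ.instVβ₂; letI := θ.instιβ
    exact kernelStepRate_mono F θ.ρ8 θ.bV h5 le_rfl hκ₅ hs.θ₅_pos.le le_rfl le_rfl hC₅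
  exact ne9_EA_objectsOfRecord₁₃_of_kernelStepRate_secondDiff F N θ ℓ hs hγ hC₅ hE₀ hC₂ h5' (decayBound_mono hdec subset_rfl hκd le_rfl)
    (kernelSecondDiff_objectsOfRecord₁₃_of_termSecondDiff F N θ ℓ hlim m' M hM S emb hloc sp hκ₀ hδ₀ hB₃ hr hM₂ hκE hΔ Ec ι Φ U hU hrU hEhol hΦemb hΦsp
      w hw₀ hw htail) hω hθω hℓκ hC₉

/-! ## §2 … with the uniform decay DISCHARGED from a PRINTED-type output bound (J41 §1b + node N18's junction) -/

open Classical in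
/-- ★★★ **THE SAME WITH `DecayBound` DISCHARGED FROM AN OUTPUT BOUND.**  §1's inputs minus `hdec`, plus the printed-type OUTPUT bound `hbd : ‖E^{(k+1)}(X; g; φ)‖ ≤ B·e^{−κ_E d_{k+1}(X)}`
on the space tables at every window history ([I] (1.18) p. 263, node N10 ∕ NODE A) ⟹ `h9` with `E₀ := E₁ = (16BB₃²∕r²)·e^{12Mδ₁}K₀K₁` and `κ_d := δ₁` — J41 §1b
`windowedDecayUniform_localizedSum_of_outputBound` + W1-21's `windowedDecayUniformOfRecord₁₃_iff_of_localizes` + node N18's `decayBound_EA_of_windowedDecayUniform`, then §1.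
LOCATED (hypothesis form); N22 NOT discharged. [folklore] -/
theorem ne9_EA_objectsOfRecord₁₃_of_kernelStepRate_termSecondDiff_outputBound (θ : Stage13Params F N) (ℓ : U3Letters₁₁) (hs : ℓ.Signs) (hγ : 0 < θ.γ)
    (hlim : PolLimitsExistOfRecord₁₃ F N θ) {κ₅ C₅ : ℝ} (hC₅ : 0 ≤ C₅) (h5 : KernelStepRateOfRecord₁₃ F N θ κ₅ ℓ.θ₅ C₅)
    (m' : ℕ) (M : ℕ) [NeZero M] (hM : M = F.L ^ m')
    (S : (K : ℕ) → ClusterTower (F.P K) 𝔸 M) (emb : ReadingMaps F (MatA N) 𝔸) (hloc : Localizes17OfRecord₁₃ F N θ S emb)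
    (sp : (K k : ℕ) → (domSys (F.P K) M (k + 1)).Dom → Set (CPair (F.P K) 𝔸))
    {κ κE δ₀ B₃ r M₂ B : ℝ}
    (hκ₀ : kappa₀ (4 * 2 ^ 4) (2 * 4) ≤ κ / 2) (hδ₀ : 0 < δ₀) (hB₃ : 0 ≤ B₃) (hr : 0 < r) (hM₂ : 0 ≤ M₂) (hB : 0 ≤ B) (hκE : κ ≤ κE)
    (hΔ : ∀ (K k : ℕ) (i : Fin (k + 1)), ∀ g ∈ box θ.γ k, ∀ (X : (domSys (F.P K) M (k + 1)).Dom), ∀ φ ∈ sp K k X, ∀ t d : ℝ, 0 < d →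
      t - d ∈ Ioc (0 : ℝ) θ.γ → t + d ∈ Ioc (0 : ℝ) θ.γ →
        ‖((S K) k).E (Function.update g i (t + d)) φ X - 2 * ((S K) k).E (Function.update g i t) φ X + ((S K) k).E (Function.update g i (t - d)) φ X‖ ≤
          M₂ * Real.exp (-(κE * (domSys (F.P K) M (k + 1)).dj X)) * d ^ 2)
    (hbd : ∀ g ∈ Window θ.γ, ∀ (K k : ℕ) (X : (domSys (F.P K) M (k + 1)).Dom), ∀ φ ∈ sp K k X,
      ‖((S K) k).E (histPrefix g k) φ X‖ ≤ B * Real.exp (-(κE * (domSys (F.P K) M (k + 1)).dj X)))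
    (Ec : ℕ → ℕ → Type*) [∀ K k, NormedAddCommGroup (Ec K k)] [∀ K k, NormedSpace ℂ (Ec K k)]
    (ι : letI := θ.instVβ₁; letI := θ.instVβ₂
      (K k : ℕ) → (domSys (F.P K) M (k + 1)).Dom → ((Fin (F.P K).d → Site (F.P K) (k + 1) → θ.Vβ) →L[ℝ] Ec K k))
    (Φ : (K k : ℕ) → (domSys (F.P K) M (k + 1)).Dom → Ec K k → CPair (F.P K) 𝔸)
    (U : (K k : ℕ) → (domSys (F.P K) M (k + 1)).Dom → Set (Ec K k)) (hU : ∀ K k X, IsOpen (U K k X)) (hrU : ∀ K k X, ball (0 : Ec K k) r ⊆ U K k X)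
    (hEhol : ∀ g ∈ Window θ.γ, ∀ (K k : ℕ) (X : (domSys (F.P K) M (k + 1)).Dom),
      DifferentiableOn ℂ (fun z => ((S K) k).E (histPrefix g k) (Φ K k X z) X) (U K k X))
    (hΦemb : letI := θ.instVβ₁; letI := θ.instVβ₂
      ∀ (K k : ℕ) (X : (domSys (F.P K) M (k + 1)).Dom) (Bf : Fin (F.P K).d → Site (F.P K) (k + 1) → θ.Vβ),
        Φ K k X (ι K k X Bf) = emb K k (fun l t => NormedSpace.exp (θ.ρ8 (Bf l t))))
    (hΦsp : ∀ (K k : ℕ) (X : (domSys (F.P K) M (k + 1)).Dom), ∀ z ∈ ball (0 : Ec K k) r, Φ K k X z ∈ sp K k X)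
    (w : (K k : ℕ) → (domSys (F.P K) M (k + 1)).Dom → Site (F.P K) (k + 1) → ℝ) (hw₀ : ∀ K k X t, 0 ≤ w K k X t)
    (hw : letI := θ.instVβ₁; letI := θ.instVβ₂; letI := θ.instιβ
      ∀ (K k : ℕ) (X : (domSys (F.P K) M (k + 1)).Dom) (l : Fin (F.P K).d) (t : Site (F.P K) (k + 1)) (c : θ.ιβ),
        ‖ι K k X (Pi.single l (Pi.single t (θ.bV c)))‖ ≤ w K k X t)
    (htail : ∀ (K k : ℕ) (X : (domSys (F.P K) M (k + 1)).Dom) (t : Site (F.P K) (k + 1)),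
      let e : Site (F.P K) (k + 1) → TPt 4 (domCount (F.P K) M (k + 1) * M) := fun x i => (ZMod.cast (x i) : ZMod (domCount (F.P K) M (k + 1) * M))
      w K k X t ≤ B₃ * Real.exp (-δ₀ * distCT (domCount (F.P K) M (k + 1)) M (e t) (nearT (M := M) (e t) X)))
    (hκ₅ : delta1 δ₀ κ ((M : ℝ) * 4) ≤ κ₅)
    (hω : 0 < ℓ.ω) (hθω : ℓ.θ₅ ≤ ℓ.ω ^ 2) (hℓκ : ℓ.κ ≤ delta1 δ₀ κ ((M : ℝ) * 4))
    (hC₉ : (4 * (2 * C₅ / (1 - ℓ.θ₅) + 2 * ((16 * B * B₃ ^ 2 / r ^ 2) * Real.exp (delta1 δ₀ κ ((M : ℝ) * 4) * ((M : ℝ) * 4) * 3) * K₀ (4 * 2 ^ 4) (2 * 4) * K₁ 4 (δ₀ / 2))) / θ.γ +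
        ((16 * M₂ * B₃ ^ 2 / r ^ 2) * Real.exp (delta1 δ₀ κ ((M : ℝ) * 4) * ((M : ℝ) * 4) * 3) * K₀ (4 * 2 ^ 4) (2 * 4) *
          K₁ 4 (δ₀ / 2)) * θ.γ / 2) / ℓ.ω ≤ ℓ.C₉) :
    NE9 ((objectsOfRecord₁₃ F N θ ℓ).EA 0) (Window θ.γ) ℓ.κ ℓ.moduli := by
  letI := θ.instVβ₁; letI := θ.instVβ₂; letI := θ.instιβ
  have hK : 0 < K₀ (4 * 2 ^ 4) (2 * 4) := K₀_pos _ _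
  have hE₁ : (0 : ℝ) ≤ ((16 * B * B₃ ^ 2 / r ^ 2) * Real.exp (delta1 δ₀ κ ((M : ℝ) * 4) * ((M : ℝ) * 4) * 3) * K₀ (4 * 2 ^ 4) (2 * 4) * K₁ 4 (δ₀ / 2)) := by
    have := K₁_nonneg 4 (δ₀ / 2); positivity
  -- the uniform decay of record from the output bound (J41 §1b, W1-21's transfer, node N18's junction)
  have hUn := windowedDecayUniform_localizedSum_of_outputBound F m' M hM S emb θ.ρ8 θ.bV sp hκ₀ hδ₀ hB₃ hr hB hκE hbd Ec ι Φ U hU hrU hEhol hΦemb hΦsp w hw₀ hw htail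
  have hRec := (windowedDecayUniformOfRecord₁₃_iff_of_localizes F N θ S emb hloc _ _).2 hUn
  have hdec : DecayBound ((objectsOfRecord₁₃ F N θ ℓ).EA 0) (Window θ.γ) ((16 * B * B₃ ^ 2 / r ^ 2) * Real.exp (delta1 δ₀ κ ((M : ℝ) * 4) * ((M : ℝ) * 4) * 3) * K₀ (4 * 2 ^ 4) (2 * 4) * K₁ 4 (δ₀ / 2)) (delta1 δ₀ κ ((M : ℝ) * 4)) :=
    decayBound_EA_of_windowedDecayUniform F _ θ.ρ8 θ.bV hlim hRec
  exact ne9_EA_objectsOfRecord₁₃_of_kernelStepRate_termSecondDiff F N θ ℓ hs hγ hlim hC₅ hE₁ h5 hdec m' M hM S emb hloc sp hκ₀ hδ₀ hB₃ hr hM₂ hκE hΔ Ec ι Φ U hU hrU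
    hEhol hΦemb hΦsp w hw₀ hw htail hκ₅ le_rfl hω hθω hℓκ hC₉

/-! ## §3 ★★★ THE SECTOR EDITION (possibility 1): `h9` from node N18's kernel step rate + SECTOR holomorphy with quadratic vanishing at zero coupling in EVERY young coupling -/

open Classical in
/-- ★★★ **K3's `h9` WITH THE RECORD's GEOMETRIC MODULI FROM NODE N18's KERNEL STEP RATE + THE PRINT-FAITHFUL (possibility-1) COUPLING DATUM.**  At a Stage-13 tuple `θ` with a letter
block `ℓ`: node N18's `KernelStepRateOfRecord₁₃ F N θ κ₅ ℓ.θ₅ C₅`; towers `S K` read through `emb` with W1-20's law; THE SECTOR DATUM `hLsec`: for every torus, level `k`, young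
coordinate `i ≤ k`, box history `g`, domain `X` and admissible `φ`, the (2.13) term `t ↦ E^{(k+1)}(X; g∣g_i := t; φ)` extends to `Ec` holomorphic on a set containing the RELATIVE closed
discs `closedBall s (c·s)`, `s ∈ ]0, θ.γ]` (a sector at zero coupling — [I] (2.12)–(2.13) p. 268: the complexified fluctuation Gaussian keeps a positive real part for `|arg g| < π∕4`;
the possibility-1 thresholds `ε₁∕‖g‖` live there, cf. this lane's 26′ `not_lastDiscs_invNorm`), with the CENTRED QUADRATIC bound `‖Ec z − V‖ ≤ B″·e^{−κ_E d_{k+1}(X)}·s²` for a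
`z`-independent value `V` ((2.13) «vanishes at g_k = 0» + the `(g, B) ↦ (−g, −B)` parity; for older coordinates the chart born at the coordinate's creation step, propagated through
the generator); the printed-type OUTPUT bound `hbd` ([I] (1.18)); term holomorphy through the readings, chart∕space clauses, tails; (1.21); the rows of §2 with
`M₂ := (6c² + 32c + 64)∕c²·B″` ⟹ **`NE9 ((objectsOfRecord₁₃ F N θ ℓ).EA 0) (Window θ.γ) ℓ.κ ℓ.moduli`** — module J45 §1 `norm_secondDiff_le_of_sectorHolo` produces the letter
`hΔ`, then §2.  NO disc through zero coupling anywhere; NO `EHoloAt`.  LOCATED (hypothesis form; the sector datum is the cell's quantitative reading, NOT a printed display);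
N22 NOT discharged. [folklore] -/
theorem ne9_EA_objectsOfRecord₁₃_of_kernelStepRate_sectorHolo (θ : Stage13Params F N) (ℓ : U3Letters₁₁) (hs : ℓ.Signs) (hγ : 0 < θ.γ)
    (hlim : PolLimitsExistOfRecord₁₃ F N θ) {κ₅ C₅ : ℝ} (hC₅ : 0 ≤ C₅) (h5 : KernelStepRateOfRecord₁₃ F N θ κ₅ ℓ.θ₅ C₅)
    (m' : ℕ) (M : ℕ) [NeZero M] (hM : M = F.L ^ m')
    (S : (K : ℕ) → ClusterTower (F.P K) 𝔸 M) (emb : ReadingMaps F (MatA N) 𝔸) (hloc : Localizes17OfRecord₁₃ F N θ S emb)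
    (sp : (K k : ℕ) → (domSys (F.P K) M (k + 1)).Dom → Set (CPair (F.P K) 𝔸))
    {κ κE δ₀ B₃ r c B'' B : ℝ} (hc : 0 < c) (hB'' : 0 ≤ B'')
    (hκ₀ : kappa₀ (4 * 2 ^ 4) (2 * 4) ≤ κ / 2) (hδ₀ : 0 < δ₀) (hB₃ : 0 ≤ B₃) (hr : 0 < r) (hB : 0 ≤ B) (hκE : κ ≤ κE)
    (hLsec : ∀ (K k : ℕ) (i : Fin (k + 1)), ∀ g ∈ box θ.γ k, ∀ (X : (domSys (F.P K) M (k + 1)).Dom), ∀ φ ∈ sp K k X,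
      ∃ (Ec : ℂ → ℂ) (O : Set ℂ) (Vc : ℂ), DifferentiableOn ℂ Ec O ∧ (∀ s ∈ Ioc (0 : ℝ) θ.γ, closedBall (s : ℂ) (c * s) ⊆ O) ∧
        (∀ s ∈ Ioc (0 : ℝ) θ.γ, ∀ z ∈ closedBall (s : ℂ) (c * s), ‖Ec z - Vc‖ ≤ B'' * Real.exp (-(κE * (domSys (F.P K) M (k + 1)).dj X)) * s ^ 2) ∧
        (∀ t ∈ Ioc (0 : ℝ) θ.γ, Ec t = ((S K) k).E (Function.update g i t) φ X))
    (hbd : ∀ g ∈ Window θ.γ, ∀ (K k : ℕ) (X : (domSys (F.P K) M (k + 1)).Dom), ∀ φ ∈ sp K k X,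
      ‖((S K) k).E (histPrefix g k) φ X‖ ≤ B * Real.exp (-(κE * (domSys (F.P K) M (k + 1)).dj X)))
    (Ec : ℕ → ℕ → Type*) [∀ K k, NormedAddCommGroup (Ec K k)] [∀ K k, NormedSpace ℂ (Ec K k)]
    (ι : letI := θ.instVβ₁; letI := θ.instVβ₂
      (K k : ℕ) → (domSys (F.P K) M (k + 1)).Dom → ((Fin (F.P K).d → Site (F.P K) (k + 1) → θ.Vβ) →L[ℝ] Ec K k))
    (Φ : (K k : ℕ) → (domSys (F.P K) M (k + 1)).Dom → Ec K k → CPair (F.P K) 𝔸)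
    (U : (K k : ℕ) → (domSys (F.P K) M (k + 1)).Dom → Set (Ec K k)) (hU : ∀ K k X, IsOpen (U K k X)) (hrU : ∀ K k X, ball (0 : Ec K k) r ⊆ U K k X)
    (hEhol : ∀ g ∈ Window θ.γ, ∀ (K k : ℕ) (X : (domSys (F.P K) M (k + 1)).Dom),
      DifferentiableOn ℂ (fun z => ((S K) k).E (histPrefix g k) (Φ K k X z) X) (U K k X))
    (hΦemb : letI := θ.instVβ₁; letI := θ.instVβ₂
      ∀ (K k : ℕ) (X : (domSys (F.P K) M (k + 1)).Dom) (Bf : Fin (F.P K).d → Site (F.P K) (k + 1) → θ.Vβ),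
        Φ K k X (ι K k X Bf) = emb K k (fun l t => NormedSpace.exp (θ.ρ8 (Bf l t))))
    (hΦsp : ∀ (K k : ℕ) (X : (domSys (F.P K) M (k + 1)).Dom), ∀ z ∈ ball (0 : Ec K k) r, Φ K k X z ∈ sp K k X)
    (w : (K k : ℕ) → (domSys (F.P K) M (k + 1)).Dom → Site (F.P K) (k + 1) → ℝ) (hw₀ : ∀ K k X t, 0 ≤ w K k X t)
    (hw : letI := θ.instVβ₁; letI := θ.instVβ₂; letI := θ.instιβ
      ∀ (K k : ℕ) (X : (domSys (F.P K) M (k + 1)).Dom) (l : Fin (F.P K).d) (t : Site (F.P K) (k + 1)) (c : θ.ιβ),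
        ‖ι K k X (Pi.single l (Pi.single t (θ.bV c)))‖ ≤ w K k X t)
    (htail : ∀ (K k : ℕ) (X : (domSys (F.P K) M (k + 1)).Dom) (t : Site (F.P K) (k + 1)),
      let e : Site (F.P K) (k + 1) → TPt 4 (domCount (F.P K) M (k + 1) * M) := fun x i => (ZMod.cast (x i) : ZMod (domCount (F.P K) M (k + 1) * M))
      w K k X t ≤ B₃ * Real.exp (-δ₀ * distCT (domCount (F.P K) M (k + 1)) M (e t) (nearT (M := M) (e t) X)))
    (hκ₅ : delta1 δ₀ κ ((M : ℝ) * 4) ≤ κ₅)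
    (hω : 0 < ℓ.ω) (hθω : ℓ.θ₅ ≤ ℓ.ω ^ 2) (hℓκ : ℓ.κ ≤ delta1 δ₀ κ ((M : ℝ) * 4))
    (hC₉ : (4 * (2 * C₅ / (1 - ℓ.θ₅) + 2 * ((16 * B * B₃ ^ 2 / r ^ 2) * Real.exp (delta1 δ₀ κ ((M : ℝ) * 4) * ((M : ℝ) * 4) * 3) * K₀ (4 * 2 ^ 4) (2 * 4) * K₁ 4 (δ₀ / 2))) / θ.γ +
        ((16 * ((6 * c ^ 2 + 32 * c + 64) / c ^ 2 * B'') * B₃ ^ 2 / r ^ 2) * Real.exp (delta1 δ₀ κ ((M : ℝ) * 4) * ((M : ℝ) * 4) * 3) * K₀ (4 * 2 ^ 4) (2 * 4) *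
          K₁ 4 (δ₀ / 2)) * θ.γ / 2) / ℓ.ω ≤ ℓ.C₉) :
    NE9 ((objectsOfRecord₁₃ F N θ ℓ).EA 0) (Window θ.γ) ℓ.κ ℓ.moduli := by
  have hc2 : 0 < c ^ 2 := by positivity
  have hM₂ : (0 : ℝ) ≤ (6 * c ^ 2 + 32 * c + 64) / c ^ 2 * B'' := by positivity
  -- the term-level second-difference letter from the sector datum (module J45 §1), coordinate by coordinate
  have hΔ : ∀ (K k : ℕ) (i : Fin (k + 1)), ∀ g ∈ box θ.γ k, ∀ (X : (domSys (F.P K) M (k + 1)).Dom), ∀ φ ∈ sp K k X, ∀ t d : ℝ, 0 < d →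
      t - d ∈ Ioc (0 : ℝ) θ.γ → t + d ∈ Ioc (0 : ℝ) θ.γ →
        ‖((S K) k).E (Function.update g i (t + d)) φ X - 2 * ((S K) k).E (Function.update g i t) φ X + ((S K) k).E (Function.update g i (t - d)) φ X‖ ≤
          (6 * c ^ 2 + 32 * c + 64) / c ^ 2 * B'' * Real.exp (-(κE * (domSys (F.P K) M (k + 1)).dj X)) * d ^ 2 := by
    intro K k i g hg X φ hφ t d hd hm hp
    obtain ⟨Ecf, O, Vc, hhol, hball, hbq, heq⟩ := hLsec K k i g hg X φ hφ
    have ht : t ∈ Ioc (0 : ℝ) θ.γ := ⟨by linarith [hm.1], by linarith [hp.2]⟩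
    have hB0 : 0 ≤ B'' * Real.exp (-(κE * (domSys (F.P K) M (k + 1)).dj X)) := by positivity
    have h := norm_secondDiff_le_of_sectorHolo (V := Vc) hc hB0 hhol hball hbq hd hm hp
    rw [heq _ hp, heq _ ht, heq _ hm] at h
    refine h.trans (le_of_eq ?_)
    ring
  exact ne9_EA_objectsOfRecord₁₃_of_kernelStepRate_termSecondDiff_outputBound F N θ ℓ hs hγ hlim hC₅ h5 m' M hM S emb hloc sp hκ₀ hδ₀ hB₃ hr hM₂ hB hκE hΔ hbd Ec ι Φ U
    hU hrU hEhol hΦemb hΦsp w hw₀ hw htail hκ₅ hω hθω hℓκ hC₉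

/-! ## §4 The N22 pin face of the sector edition -/

open Classical in
/-- ★★★ **THE N22 PIN FACE FROM NODE N18's KERNEL STEP RATE + THE SECTOR DATUM** — `N22At (rateCarriersOfRecord₁₃CoPH 𝔯 F θ hP g₀ os k).u3` for EVERY `k` under the node-U3 pin
`hpin` at the tuple (dag-n22-w3's `n22At_rateCarriers_of_kernels_pin_of_ne9` on §3 at `θ.toStage13Params`).  THE N22 ROW SENTENCE, possibility-1 currency: «N18's kernel step rate +
SECTOR holomorphy of the (2.13) terms in each young coupling with quadratic vanishing at zero coupling + the printed output bound (1.18) + term holomorphy through the readings + p. 282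
tails + W1-20's law + (1.21) + letter rows ⇒ §2b `h9` ∕ `N22At` WITH THE RECORD's GEOMETRIC MODULI» — no disc through `g = 0`, no `EHoloAt`. [folklore] -/
theorem n22At_rateCarriers_of_kernels_pin_of_kernelStepRate_sectorHolo (𝔯 : RateReading₁₃CoPH N) (θ : Stage13HParams F N) (hP : θ.Provisos₁₃CoPH F N)
    (g₀ : ℕ → ℝ) (os : List (ULoop F)) (ℓ : U3Letters₁₁) (hs : ℓ.Signs) (hγ : 0 < θ.γ)
    (hpin : (𝔯.lit F θ hP g₀ os).u3 = objectsOfRecord₁₃ F N θ.toStage13Params ℓ)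
    (hlim : PolLimitsExistOfRecord₁₃ F N θ.toStage13Params) {κ₅ C₅ : ℝ} (hC₅ : 0 ≤ C₅) (h5 : KernelStepRateOfRecord₁₃ F N θ.toStage13Params κ₅ ℓ.θ₅ C₅)
    (m' : ℕ) (M : ℕ) [NeZero M] (hM : M = F.L ^ m')
    (S : (K : ℕ) → ClusterTower (F.P K) 𝔸 M) (emb : ReadingMaps F (MatA N) 𝔸) (hloc : Localizes17OfRecord₁₃ F N θ.toStage13Params S emb)
    (sp : (K k : ℕ) → (domSys (F.P K) M (k + 1)).Dom → Set (CPair (F.P K) 𝔸))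
    {κ κE δ₀ B₃ r c B'' B : ℝ} (hc : 0 < c) (hB'' : 0 ≤ B'')
    (hκ₀ : kappa₀ (4 * 2 ^ 4) (2 * 4) ≤ κ / 2) (hδ₀ : 0 < δ₀) (hB₃ : 0 ≤ B₃) (hr : 0 < r) (hB : 0 ≤ B) (hκE : κ ≤ κE)
    (hLsec : ∀ (K k : ℕ) (i : Fin (k + 1)), ∀ g ∈ box θ.γ k, ∀ (X : (domSys (F.P K) M (k + 1)).Dom), ∀ φ ∈ sp K k X,
      ∃ (Ec : ℂ → ℂ) (O : Set ℂ) (Vc : ℂ), DifferentiableOn ℂ Ec O ∧ (∀ s ∈ Ioc (0 : ℝ) θ.γ, closedBall (s : ℂ) (c * s) ⊆ O) ∧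
        (∀ s ∈ Ioc (0 : ℝ) θ.γ, ∀ z ∈ closedBall (s : ℂ) (c * s), ‖Ec z - Vc‖ ≤ B'' * Real.exp (-(κE * (domSys (F.P K) M (k + 1)).dj X)) * s ^ 2) ∧
        (∀ t ∈ Ioc (0 : ℝ) θ.γ, Ec t = ((S K) k).E (Function.update g i t) φ X))
    (hbd : ∀ g ∈ Window θ.γ, ∀ (K k : ℕ) (X : (domSys (F.P K) M (k + 1)).Dom), ∀ φ ∈ sp K k X,
      ‖((S K) k).E (histPrefix g k) φ X‖ ≤ B * Real.exp (-(κE * (domSys (F.P K) M (k + 1)).dj X)))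
    (Ec : ℕ → ℕ → Type*) [∀ K k, NormedAddCommGroup (Ec K k)] [∀ K k, NormedSpace ℂ (Ec K k)]
    (ι : letI := θ.instVβ₁; letI := θ.instVβ₂
      (K k : ℕ) → (domSys (F.P K) M (k + 1)).Dom → ((Fin (F.P K).d → Site (F.P K) (k + 1) → θ.Vβ) →L[ℝ] Ec K k))
    (Φ : (K k : ℕ) → (domSys (F.P K) M (k + 1)).Dom → Ec K k → CPair (F.P K) 𝔸)
    (U : (K k : ℕ) → (domSys (F.P K) M (k + 1)).Dom → Set (Ec K k)) (hU : ∀ K k X, IsOpen (U K k X)) (hrU : ∀ K k X, ball (0 : Ec K k) r ⊆ U K k X)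
    (hEhol : ∀ g ∈ Window θ.γ, ∀ (K k : ℕ) (X : (domSys (F.P K) M (k + 1)).Dom),
      DifferentiableOn ℂ (fun z => ((S K) k).E (histPrefix g k) (Φ K k X z) X) (U K k X))
    (hΦemb : letI := θ.instVβ₁; letI := θ.instVβ₂
      ∀ (K k : ℕ) (X : (domSys (F.P K) M (k + 1)).Dom) (Bf : Fin (F.P K).d → Site (F.P K) (k + 1) → θ.Vβ),
        Φ K k X (ι K k X Bf) = emb K k (fun l t => NormedSpace.exp (θ.ρ8 (Bf l t))))
    (hΦsp : ∀ (K k : ℕ) (X : (domSys (F.P K) M (k + 1)).Dom), ∀ z ∈ ball (0 : Ec K k) r, Φ K k X z ∈ sp K k X)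
    (w : (K k : ℕ) → (domSys (F.P K) M (k + 1)).Dom → Site (F.P K) (k + 1) → ℝ) (hw₀ : ∀ K k X t, 0 ≤ w K k X t)
    (hw : letI := θ.instVβ₁; letI := θ.instVβ₂; letI := θ.instιβ
      ∀ (K k : ℕ) (X : (domSys (F.P K) M (k + 1)).Dom) (l : Fin (F.P K).d) (t : Site (F.P K) (k + 1)) (c : θ.ιβ),
        ‖ι K k X (Pi.single l (Pi.single t (θ.bV c)))‖ ≤ w K k X t)
    (htail : ∀ (K k : ℕ) (X : (domSys (F.P K) M (k + 1)).Dom) (t : Site (F.P K) (k + 1)),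
      let e : Site (F.P K) (k + 1) → TPt 4 (domCount (F.P K) M (k + 1) * M) := fun x i => (ZMod.cast (x i) : ZMod (domCount (F.P K) M (k + 1) * M))
      w K k X t ≤ B₃ * Real.exp (-δ₀ * distCT (domCount (F.P K) M (k + 1)) M (e t) (nearT (M := M) (e t) X)))
    (hκ₅ : delta1 δ₀ κ ((M : ℝ) * 4) ≤ κ₅)
    (hω : 0 < ℓ.ω) (hθω : ℓ.θ₅ ≤ ℓ.ω ^ 2) (hℓκ : ℓ.κ ≤ delta1 δ₀ κ ((M : ℝ) * 4))
    (hC₉ : (4 * (2 * C₅ / (1 - ℓ.θ₅) + 2 * ((16 * B * B₃ ^ 2 / r ^ 2) * Real.exp (delta1 δ₀ κ ((M : ℝ) * 4) * ((M : ℝ) * 4) * 3) * K₀ (4 * 2 ^ 4) (2 * 4) * K₁ 4 (δ₀ / 2))) / θ.γ +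
        ((16 * ((6 * c ^ 2 + 32 * c + 64) / c ^ 2 * B'') * B₃ ^ 2 / r ^ 2) * Real.exp (delta1 δ₀ κ ((M : ℝ) * 4) * ((M : ℝ) * 4) * 3) * K₀ (4 * 2 ^ 4) (2 * 4) *
          K₁ 4 (δ₀ / 2)) * θ.γ / 2) / ℓ.ω ≤ ℓ.C₉) (k : ℕ) :
    N22At (rateCarriersOfRecord₁₃CoPH 𝔯 F θ hP g₀ os k).u3 :=
  n22At_rateCarriers_of_kernels_pin_of_ne9 𝔯 θ hP g₀ os ℓ hs hpin
    (ne9_EA_objectsOfRecord₁₃_of_kernelStepRate_sectorHolo F N θ.toStage13Params ℓ hs hγ hlim hC₅ h5 m' M hM S emb hloc sp hc hB'' hκ₀ hδ₀ hB₃ hr hB hκE hLsec hbd Ec ι Φ U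
      hU hrU hEhol hΦemb hΦsp w hw₀ hw htail hκ₅ hω hθω hℓκ hC₉) k

end YMDAG.N22.KernelFading

end
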